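import Summits.NavierStokesRegularity.NavierStokesRegularity.Theorems.PerpetualPumpAveragedTypeIBlowupHandoffSlow

/-!
# Crux `PerpetualPump.AveragedTypeIBlowup` (stmt-NavierStokesRegularity-1835), line `Sketch`:
# stub `preBoot` — clock algebra for the slow-time mode packages

First tools file of the proof of the registered stub `stub_preBoot` (the pre-ignition bootstrap of
the window one-step theorem; Mathlib-only mathematics). Every mode of the critical Toda system is
read in the slow time `σ = Rc (t − tb)` of a clock `Rc` from a base time `tb` through the mode
packages `handoff_modePkg` / `handoff_sysPkg` of `…HandoffSlow` (continuity, the derivative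
`κ(−x + g) + e` with a continuous error `|e| ≤ η κ M` on the closed slow interval, the Duhamel
restart inequality from slow time `0` — the common hypothesis shape of the phase lemmas
`stub_incubation`, `stub_previousPairTrunc`, `stub_levelOnePre`, `stub_slavedLadder`,
`stub_trailPairLoose`). This file adds the clock algebra (`preBoot_time`, registered tools
sub-goal `stub_preBootClock`) and the passage slow time ↔ real time of statements quantified
over an interval (`preBoot_pull`, `preBoot_push`).

## References

T. Tao, *Finite time blowup for an averaged three-dimensional Navier–Stokes equation*, J. Amer.
Math. Soc. 29 (2016), §5–6 (the cascade heuristics); the content here is folklore calculus.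
-/

noncomputable section

-- the summit namespace `…NavierStokesRegularity.NavierStokesRegularity…` is the tree convention
set_option linter.dupNamespace false

open Set MeasureTheory Filter Topology

namespace Summit.NavierStokesRegularity.NavierStokesRegularity.Theorems.PerpetualPumpAveragedTypeIBlowup

/-- **Clock algebra**: `tb + R(s − tb)/R = s`, `R((tb + σ/R) − tb) = σ`, `tb + 0/R = tb`.
[folklore] -/
theorem preBoot_time {tb R : ℝ} (hR : R ≠ 0) :
    (∀ s : ℝ, tb + R * (s - tb) / R = s) ∧ (∀ σ : ℝ, R * ((tb + σ / R) - tb) = σ) ∧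
      tb + 0 / R = tb := by
  refine ⟨fun s => ?_, fun σ => ?_, by simp⟩
  · field_simp
    ring
  · field_simp
    ring

/-- **From slow time back to real time** (`σ = Rc(s − tb)`): a statement for all
`σ ∈ [0, Rc(s₁ − tb)]` at the real time `tb + σ/Rc` is a statement for all `s ∈ [tb, s₁]`; same
for the half-open intervals `(0, S]` / `(tb, s₁]`. [folklore] -/
theorem preBoot_pull {P : ℝ → Prop} {tb Rc s₁ : ℝ} (hRc : 0 < Rc) :
    ((∀ σ ∈ Icc 0 (Rc * (s₁ - tb)), P (tb + σ / Rc)) → ∀ s ∈ Icc tb s₁, P s) ∧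
    ((∀ σ ∈ Ioc 0 (Rc * (s₁ - tb)), P (tb + σ / Rc)) → ∀ s ∈ Ioc tb s₁, P s) := by
  have hid : ∀ s : ℝ, tb + Rc * (s - tb) / Rc = s := (preBoot_time hRc.ne').1
  refine ⟨fun h s hs => ?_, fun h s hs => ?_⟩
  · have := h (Rc * (s - tb)) ⟨mul_nonneg hRc.le (by linarith [hs.1]),
      mul_le_mul_of_nonneg_left (by linarith [hs.2]) hRc.le⟩
    rwa [hid] at this
  · have := h (Rc * (s - tb)) ⟨mul_pos hRc (by linarith [hs.1]),
      mul_le_mul_of_nonneg_left (by linarith [hs.2]) hRc.le⟩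
    rwa [hid] at this

/-- **From real time to slow time**: a statement for all `s ∈ [tb, s₁]` gives one for all
`σ ∈ [0, Rc(s₁ − tb)]` at `tb + σ/Rc`; and `tb + σ/Rc ∈ [tb, s₁]`. [folklore] -/
theorem preBoot_push {tb Rc s₁ : ℝ} (hRc : 0 < Rc) :
    (∀ σ ∈ Icc 0 (Rc * (s₁ - tb)), tb + σ / Rc ∈ Icc tb s₁) ∧
    ∀ {P : ℝ → Prop}, (∀ s ∈ Icc tb s₁, P s) → ∀ σ ∈ Icc 0 (Rc * (s₁ - tb)), P (tb + σ / Rc) := by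
  have hmem : ∀ σ ∈ Icc 0 (Rc * (s₁ - tb)), tb + σ / Rc ∈ Icc tb s₁ := by
    intro σ hσ
    have h0 : 0 ≤ σ / Rc := div_nonneg hσ.1 hRc.le
    have h1 : σ / Rc ≤ Rc * (s₁ - tb) / Rc := div_le_div_of_nonneg_right hσ.2 hRc.le
    rw [mul_div_cancel_left₀ _ hRc.ne'] at h1
    exact ⟨by linarith, by linarith⟩
  exact ⟨hmem, fun h σ hσ => h _ (hmem σ hσ)⟩

/-- **Registered tools sub-goal `stub_preBootClock`** of the stub `preBoot` (line `Sketch`, crux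
stmt-NavierStokesRegularity-1835): the clock algebra of the slow time `σ = R(s − tb)`,
`tb + R(s − tb)/R = s`, `R((tb + σ/R) − tb) = σ`, `tb + 0/R = tb` (`preBoot_time`). [folklore] -/
theorem stub_preBootClock :
    ∀ (tb R : ℝ), R ≠ 0 →
      (∀ s : ℝ, tb + R * (s - tb) / R = s) ∧ (∀ σ : ℝ, R * ((tb + σ / R) - tb) = σ) ∧
        tb + 0 / R = tb :=
  fun _ _ hR => preBoot_time hR

end Summit.NavierStokesRegularity.NavierStokesRegularity.Theorems.PerpetualPumpAveragedTypeIBlowup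

end
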